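import Summits.AtomisticToContinuum.BoseEinsteinCondensation.Theorems.BECSwapNoCatastropheTorusHalfSwapOverlapSwapInvariance
import Summits.AtomisticToContinuum.BoseEinsteinCondensation.Theorems.BECSwapNoCatastropheTorusHalfSwapOverlapSymmetricInfimum
import Literature.Barriers.AtomisticToContinuum.KineticGapLengthScalesThermodynamicWindow
import HarnessLib

/-!
# Crux `TorusHalfSwapOverlap` (stmt-AtomisticToContinuum-14393), line `birth`: stub `stub_nonVacuity` (S5b)

Route `BECSwapNoCatastrophe` (sub-problem `BoseEinsteinCondensation`), lead c5 (2026-08-17). NON-VACUITY OF THE NEAR-MINIMISER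
FRAMES of the midpoint-chord claim: given the append embedding (S5a, hypothesis verbatim), for every repulsive finite-range `v`
there is `ρ₀ > 0` such that for `0 < ρ < ρ₀` and all large `n`, on the two-copy torus of side `L = sideLength ρ (n+1)`, the
swap-symmetric and the absolute infima of the half-swapped form `E2(½)`, the absolute infimum of the uncoupled form `E2(0)`,
and the one-copy periodic ground-state energy `E₀^per(n+1, L)` are all finite. Mechanism: Ruelle finiteness of the torus
energies (`Literature.Barriers.AtomisticToContinuum.BoseGas.exists_eventually_periodicGroundStateEnergy_lt_top`) at density
`2ρ` for `(n+1)+(n+1)` particles, `sideLength (2ρ) ((n+1)+(n+1)) = sideLength ρ (n+1)`, a finite-energy `Ξ` embedded by S5a,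
and `stub_symmetricInfimum stub_swapInvariance` (landed) for the swap-symmetric infimum. [folklore]
-/

noncomputable section

open MeasureTheory Filter
open scoped ENNReal NNReal BigOperators ComplexConjugate

namespace Summit.AtomisticToContinuum.BoseEinsteinCondensation.Cruxes.TorusHalfSwapOverlap.Birth

open Literature.MathematicalPhysics.QuantumManyBody.BoseGas

namespace NonVacuity

/-- Doubling the particle number and the density leaves the torus side unchanged:
`sideLength (2ρ) (2N) = sideLength ρ N` for `N = n + 1` (`(2N)/(2ρ) = N/ρ`). [folklore] -/
theorem sideLength_two_mul_double {ρ : ℝ} (hρ : ρ ≠ 0) (n : ℕ) :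
    sideLength (2 * ρ) (n + 1 + (n + 1)) = sideLength ρ (n + 1) := by
  unfold sideLength
  congr 1
  push_cast
  field_simp
  ring

end NonVacuity

open NonVacuity

/-! ### The registered stub -/

/-- S5b — `stub_nonVacuity` (S/M; worker): S5a ⇒ the near-minimiser frames of the chord are non-vacuous at small density,
eventually in `n` (Ruelle finiteness at density `2ρ`). -/
theorem stub_nonVacuity :
    (∀ v : ℝ → ℝ≥0∞, IsRepulsiveFiniteRange v → ∀ (n : ℕ) (L : ℝ) (Ξ : PeriodicTrialState ((n + 1) + (n + 1)) L),
      let C2 : Set (Config (n + 1) × Config (n + 1)) := (cellN (n + 1) L) ×ˢ (cellN (n + 1) L)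
      let E2z : (Config (n + 1) × Config (n + 1) → ℂ) → ℝ≥0∞ := fun Θ => ∫⁻ Z in C2,
        kineticDensity (fun X => Θ (X, Z.2)) Z.1 + kineticDensity (fun Y => Θ (Z.1, Y)) Z.2 +
          (periodicInteraction v L Z.1 + periodicInteraction v L Z.2) * (‖Θ Z‖₊ : ENNReal) ^ 2
      let E2h : (Config (n + 1) × Config (n + 1) → ℂ) → ℝ≥0∞ := fun Θ => ∫⁻ Z in C2,
        (kineticDensity (fun X => Θ (X, Z.2)) Z.1 + kineticDensity (fun Y => Θ (Z.1, Y)) Z.2 +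
          (periodicInteraction v L (Fin.tail Z.1) + periodicInteraction v L (Fin.tail Z.2) +
            ∑ j : Fin n, (2 : ENNReal)⁻¹ * (periodizedPotential v L (Z.1 0 - Z.1 j.succ) +
              periodizedPotential v L (Z.2 0 - Z.2 j.succ) + periodizedPotential v L (Z.2 0 - Z.1 j.succ) +
              periodizedPotential v L (Z.1 0 - Z.2 j.succ))) * (‖Θ Z‖₊ : ENNReal) ^ 2)
      let Adm : (Config (n + 1) × Config (n + 1) → ℂ) → Prop := fun Θ => ContDiff ℝ 1 Θ ∧
        (∀ (Z : Config (n + 1) × Config (n + 1)) (i : Fin (n + 1)) (k : Fin 3),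
          Θ (Z.1 + Pi.single i (EuclideanSpace.single k L), Z.2) = Θ Z ∧
            Θ (Z.1, Z.2 + Pi.single i (EuclideanSpace.single k L)) = Θ Z) ∧
        ∫⁻ Z in C2, (‖Θ Z‖₊ : ENNReal) ^ 2 = 1
      let Θ : Config (n + 1) × Config (n + 1) → ℂ := fun Z => Ξ.ψ (Fin.append Z.1 Z.2)
      Adm Θ ∧ E2h Θ ≤ periodicEnergy v Ξ ∧ E2z Θ ≤ periodicEnergy v Ξ) →
      ∀ v : ℝ → ℝ≥0∞, IsRepulsiveFiniteRange v →
        ∃ ρ₀ : ℝ, 0 < ρ₀ ∧ ∀ ρ : ℝ, 0 < ρ → ρ < ρ₀ → ∀ᶠ n : ℕ in atTop,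
          let L : ℝ := sideLength ρ (n + 1)
          let C2 : Set (Config (n + 1) × Config (n + 1)) := (cellN (n + 1) L) ×ˢ (cellN (n + 1) L)
          let E2z : (Config (n + 1) × Config (n + 1) → ℂ) → ℝ≥0∞ := fun Θ => ∫⁻ Z in C2,
            kineticDensity (fun X => Θ (X, Z.2)) Z.1 + kineticDensity (fun Y => Θ (Z.1, Y)) Z.2 +
              (periodicInteraction v L Z.1 + periodicInteraction v L Z.2) * (‖Θ Z‖₊ : ENNReal) ^ 2
          let E2h : (Config (n + 1) × Config (n + 1) → ℂ) → ℝ≥0∞ := fun Θ => ∫⁻ Z in C2,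
            (kineticDensity (fun X => Θ (X, Z.2)) Z.1 + kineticDensity (fun Y => Θ (Z.1, Y)) Z.2 +
              (periodicInteraction v L (Fin.tail Z.1) + periodicInteraction v L (Fin.tail Z.2) +
                ∑ j : Fin n, (2 : ENNReal)⁻¹ * (periodizedPotential v L (Z.1 0 - Z.1 j.succ) +
                  periodizedPotential v L (Z.2 0 - Z.2 j.succ) + periodizedPotential v L (Z.2 0 - Z.1 j.succ) +
                  periodizedPotential v L (Z.1 0 - Z.2 j.succ))) * (‖Θ Z‖₊ : ENNReal) ^ 2)
          let Adm : (Config (n + 1) × Config (n + 1) → ℂ) → Prop := fun Θ => ContDiff ℝ 1 Θ ∧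
            (∀ (Z : Config (n + 1) × Config (n + 1)) (i : Fin (n + 1)) (k : Fin 3),
              Θ (Z.1 + Pi.single i (EuclideanSpace.single k L), Z.2) = Θ Z ∧
                Θ (Z.1, Z.2 + Pi.single i (EuclideanSpace.single k L)) = Θ Z) ∧
            ∫⁻ Z in C2, (‖Θ Z‖₊ : ENNReal) ^ 2 = 1
          let AdmS : (Config (n + 1) × Config (n + 1) → ℂ) → Prop := fun Θ => ContDiff ℝ 1 Θ ∧
            (∀ (Z : Config (n + 1) × Config (n + 1)) (i : Fin (n + 1)) (k : Fin 3),
              Θ (Z.1 + Pi.single i (EuclideanSpace.single k L), Z.2) = Θ Z ∧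
                Θ (Z.1, Z.2 + Pi.single i (EuclideanSpace.single k L)) = Θ Z) ∧
            (∀ X Y : Config (n + 1), Θ (Matrix.vecCons (Y 0) (Fin.tail X), Matrix.vecCons (X 0) (Fin.tail Y)) = Θ (X, Y)) ∧
            ∫⁻ Z in C2, (‖Θ Z‖₊ : ENNReal) ^ 2 = 1
          (⨅ (Θ' : Config (n + 1) × Config (n + 1) → ℂ) (_ : AdmS Θ'), E2h Θ') < ⊤ ∧
            (⨅ (Θ' : Config (n + 1) × Config (n + 1) → ℂ) (_ : Adm Θ'), E2h Θ') < ⊤ ∧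
            (⨅ (Θ' : Config (n + 1) × Config (n + 1) → ℂ) (_ : Adm Θ'), E2z Θ') < ⊤ ∧
            periodicGroundStateEnergy v (n + 1) L < ⊤ := by
  intro hA v hv
  obtain ⟨ρ₁, hρ₁, hfin⟩ :=
    Literature.Barriers.AtomisticToContinuum.BoseGas.exists_eventually_periodicGroundStateEnergy_lt_top hv
  refine ⟨ρ₁ / 2, half_pos hρ₁, fun ρ hρ hρ₀ => ?_⟩
  have hρ1 : ρ < ρ₁ := hρ₀.trans (half_lt_self hρ₁)
  have h2ρ : 0 < 2 * ρ := by positivity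
  have h2ρ1 : 2 * ρ < ρ₁ := by linarith
  -- (a) one-copy finiteness along `N = n + 1`
  have ha : ∀ᶠ n : ℕ in atTop, periodicGroundStateEnergy v (n + 1) (sideLength ρ (n + 1)) < ⊤ :=
    (tendsto_add_atTop_nat 1).eventually (hfin ρ hρ hρ1)
  -- (b) finiteness at the double density along `N = (n + 1) + (n + 1)`
  have hT : Tendsto (fun n : ℕ => n + 1 + (n + 1)) atTop atTop :=
    tendsto_atTop_atTop.2 fun b => ⟨b, fun n hn => by omega⟩
  have hb : ∀ᶠ n : ℕ in atTop,
      periodicGroundStateEnergy v (n + 1 + (n + 1)) (sideLength (2 * ρ) (n + 1 + (n + 1))) < ⊤ :=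
    hT.eventually (hfin (2 * ρ) h2ρ h2ρ1)
  filter_upwards [ha, hb] with n h1 h2
  intro L C2 E2z E2h Adm AdmS
  -- (c) same torus: extract a finite-energy `2(n+1)`-particle periodic state on the side-`L` torus
  rw [NonVacuity.sideLength_two_mul_double hρ.ne' n, periodicGroundStateEnergy, iInf_lt_top] at h2
  obtain ⟨Ξ, hΞ⟩ := h2
  -- (d) the append embedding (S5a) makes it an absolutely admissible two-copy trial function
  have key : Adm (fun Z => Ξ.ψ (Fin.append Z.1 Z.2)) ∧
      E2h (fun Z => Ξ.ψ (Fin.append Z.1 Z.2)) ≤ periodicEnergy v Ξ ∧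
        E2z (fun Z => Ξ.ψ (Fin.append Z.1 Z.2)) ≤ periodicEnergy v Ξ :=
    hA v hv n L Ξ
  obtain ⟨hAdm, hEh, hEz⟩ := key
  -- (e) swap-symmetric infimum = absolute infimum (landed stubs S2a, S2b)
  have hsym : (⨅ (Θ' : Config (n + 1) × Config (n + 1) → ℂ) (_ : AdmS Θ'), E2h Θ') =
      ⨅ (Θ' : Config (n + 1) × Config (n + 1) → ℂ) (_ : Adm Θ'), E2h Θ' :=
    stub_symmetricInfimum stub_swapInvariance v hv n L
  have hh : (⨅ (Θ' : Config (n + 1) × Config (n + 1) → ℂ) (_ : Adm Θ'), E2h Θ') < ⊤ :=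
    iInf_lt_top.2 ⟨_, iInf_lt_top.2 ⟨hAdm, hEh.trans_lt hΞ⟩⟩
  have hz : (⨅ (Θ' : Config (n + 1) × Config (n + 1) → ℂ) (_ : Adm Θ'), E2z Θ') < ⊤ :=
    iInf_lt_top.2 ⟨_, iInf_lt_top.2 ⟨hAdm, hEz.trans_lt hΞ⟩⟩
  exact ⟨hsym.trans_lt hh, hh, hz, h1⟩

end Summit.AtomisticToContinuum.BoseEinsteinCondensation.Cruxes.TorusHalfSwapOverlap.Birth

end
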